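import Mathlib
import Summits.NavierStokesRegularity.NavierStokesRegularity.Theorems.ThreadingFluxHorizonTowerQuadraticGenerator
import Summits.NavierStokesRegularity.NavierStokesRegularity.Theorems.ThreadingFluxHorizonTowerNullConeChart
import Summits.NavierStokesRegularity.NavierStokesRegularity.Theorems.ThreadingFluxHorizonTowerNullConeInjective
import HarnessLib

/-!
# Crux `PoloidalLiouville` (stmt-NavierStokesRegularity-1222), crux idea «horizon-threading-tower» (ns-idea-15):
# THE QUADRATIC GENERATOR, III — null-cone charts, degree-two chart surjectivity, and REALITY of the generator

Support file (`--supports stmt-NavierStokesRegularity-1222`, helper; cell `ns-wall-extremal`, width hand ns-wall-eng-3 g5; 0 kit), toward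
THM E «the finite tower `{2, 4, 6}` is coaxially zonal at order one».

* Coefficient maps and scaling: `map φ (genA Q) = genA (φ Q)`, `genA (w•Q) = w² genA Q`, `genB (w•Q) = w³ genB Q`; the five
  parameters are values of `L` (`eval_genL_*`), so `L` determines `Q`.
* ★ THE CHART IS MULTIPLICATIVE MODULO `ρ` (the load-bearing step named by ns-wall-crit-1 g5, batch #28): on the isotropic chart
  (`Zonal.chartT`, which kills `ρ`-multiples) `chartT (genA Q) = 35 · (chartT L)²` and `chartT (genB Q) = 77 · (chartT L)³`; with the
  INJECTIVITY of the chart on solid harmonics (`eq_zero_of_chartT_eq_zero`, p702364): a complex solid harmonic of degree 4 (resp. 6)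
  whose chart is `c · (chartT L)²` (resp. `c · (chartT L)³`) IS `(c/35) · genA Q` (resp. `(c/77) · genB Q`).
* ★ DEGREE-TWO CHART SURJECTIVITY: every `q ∈ ℂ[t]` of degree `≤ 4` is `chartT (genL Q)` for an explicit traceless symmetric `Q`
  (`chartT L = (a − b + 2id) + 4(e + if) t − 6(a + b) t² + 4(−e + if) t³ + (a − b − 2id) t⁴`).
* ★ REALITY OF THE GENERATOR: if a non-zero REAL polynomial `P` satisfies `P = c · genA Q` over `ℂ` (complex `c`, complex `Q`), then
  `Q = w • Q'` with `Q'` REAL (complex conjugation fixes `P`, so `c̄ · genA Q̄ = c · genA Q`; charts give `(chartT L_{Q̄})² = (c/c̄)(chartT L_Q)²`,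
  hence `L_{Q̄} = u · L_Q` with `|u| = 1` by injectivity, and `w̄ = w⁻¹` with `w² = u` makes `w • Q` real).

HONEST LABEL: polynomial identities about one crux idea's typed objects; no Prop of the sketch is closed here; `HorizonTowerZonality`
(general towers), `PoloidalLiouville` (1222) OPEN; NS regularity NOT proved.  [folklore]
-/

-- the summit and its single sub-problem share the name (CONVENTIONS §1)
set_option linter.dupNamespace false

noncomputable section

open MvPolynomial Complex

namespace Summit.NavierStokesRegularity.NavierStokesRegularity.Theorems.PoloidalLiouville.HorizonTower.Zonal

section Generic

variable {R : Type*} [CommRing R] (a b d e f : R)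
variable {S : Type*} [CommRing S] (φ : R →+* S)

/-! ### Coefficient maps, scaling, linearity in the parameters, values -/

/-- `ρ` is defined over every ring. [folklore] -/
theorem map_normSq : map φ (normSq : MvPolynomial (Fin 3) R) = normSq := by
  simp only [normSq, map_add, map_pow, map_X]

/-- The generator commutes with coefficient maps. [folklore] -/
theorem map_genL : map φ (genL a b d e f) = genL (φ a) (φ b) (φ d) (φ e) (φ f) := by
  simp only [genL, genQ0, genQ1, genQ2, map_add, map_sub, map_mul, map_X, map_C]

/-- `A` commutes with coefficient maps. [folklore] -/
theorem map_genA : map φ (genA a b d e f) = genA (φ a) (φ b) (φ d) (φ e) (φ f) := by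
  simp only [genA, genL, genM, genQ0, genQ1, genQ2, genTau, normSq, map_add, map_sub, map_mul, map_pow, map_X, map_C,
    map_ofNat]

/-- `B` commutes with coefficient maps. [folklore] -/
theorem map_genB : map φ (genB a b d e f) = genB (φ a) (φ b) (φ d) (φ e) (φ f) := by
  simp only [genB, genL, genM, genQ0, genQ1, genQ2, genTau, genDelta, normSq, map_add, map_sub, map_mul, map_pow, map_neg,
    map_X, map_C, map_ofNat]

/-- Scaling the parameters scales the generator: `L(w•Q) = w L(Q)`. [folklore] -/
theorem genL_smul (w : R) : genL (w * a) (w * b) (w * d) (w * e) (w * f) = C w * genL a b d e f := by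
  simp only [genL, genQ0, genQ1, genQ2, map_mul, map_add]; ring

/-- `A(w•Q) = w² A(Q)`. [folklore] -/
theorem genA_smul (w : R) : genA (w * a) (w * b) (w * d) (w * e) (w * f) = C (w ^ 2) * genA a b d e f := by
  simp only [genA, genL, genM, genQ0, genQ1, genQ2, genTau, map_mul, map_add, map_pow, map_ofNat]; ring

/-- `B(w•Q) = w³ B(Q)`. [folklore] -/
theorem genB_smul (w : R) : genB (w * a) (w * b) (w * d) (w * e) (w * f) = C (w ^ 3) * genB a b d e f := by
  simp only [genB, genL, genM, genQ0, genQ1, genQ2, genTau, genDelta, map_mul, map_add, map_pow, map_sub, map_neg,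
    map_ofNat]
  ring

/-- The generator is linear in the parameters: differences. [folklore] -/
theorem genL_sub (a' b' d' e' f' : R) :
    genL (a - a') (b - b') (d - d') (e - e') (f - f') = genL a b d e f - genL a' b' d' e' f' := by
  simp only [genL, genQ0, genQ1, genQ2, map_sub, map_add]; ring

/-- `L(1,0,0) = a`. [folklore] -/
theorem eval_genL_e0 : eval ![1, 0, 0] (genL a b d e f) = a := by
  simp [genL, genQ0, genQ1, genQ2]
/-- `L(0,1,0) = b`. [folklore] -/
theorem eval_genL_e1 : eval ![0, 1, 0] (genL a b d e f) = b := by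
  simp [genL, genQ0, genQ1, genQ2]
/-- `L(1,1,0) = a + b + 2d`. [folklore] -/
theorem eval_genL_e01 : eval ![1, 1, 0] (genL a b d e f) = a + b + 2 * d := by
  simp [genL, genQ0, genQ1, genQ2]; ring
/-- `L(1,0,1) = 2e − b`. [folklore] -/
theorem eval_genL_e02 : eval ![1, 0, 1] (genL a b d e f) = 2 * e - b := by
  simp [genL, genQ0, genQ1, genQ2]; ring
/-- `L(0,1,1) = 2f − a`. [folklore] -/
theorem eval_genL_e12 : eval ![0, 1, 1] (genL a b d e f) = 2 * f - a := by
  simp [genL, genQ0, genQ1, genQ2]; ring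

end Generic

/-! ### The generator vanishes only for the zero matrix (characteristic zero) -/

/-- Over `ℂ`: `L = 0` forces `Q = 0`. [folklore] -/
theorem gen_eq_zero_of_genL_eq_zero {a b d e f : ℂ} (h : genL a b d e f = 0) :
    a = 0 ∧ b = 0 ∧ d = 0 ∧ e = 0 ∧ f = 0 := by
  have ha := eval_genL_e0 a b d e f
  have hb := eval_genL_e1 a b d e f
  have hd := eval_genL_e01 a b d e f
  have he := eval_genL_e02 a b d e f
  have hf := eval_genL_e12 a b d e f
  rw [h, map_zero] at ha hb hd he hf
  refine ⟨ha.symm, hb.symm, ?_, ?_, ?_⟩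
  · linear_combination (-(1 : ℂ) / 2) * hd + (1 / 2) * ha + (1 / 2) * hb
  · linear_combination (-(1 : ℂ) / 2) * he - (1 / 2) * hb
  · linear_combination (-(1 : ℂ) / 2) * hf - (1 / 2) * ha

/-! ### Null-cone charts of the generator algebra -/

section Chart

variable (a b d e f : ℂ)

/-- `chartT ρ = 0`. [folklore] -/
theorem chartT_normSq : chartT (normSq : MvPolynomial (Fin 3) ℂ) = 0 := by
  rw [normSq, chartT_add, chartT_add, chartT_pow, chartT_pow, chartT_pow, chartT_X_sq_sum]

/-- ★ **THE CHART IS MULTIPLICATIVE MODULO `ρ`, degree 4**: `chartT A = 35 · (chartT L)²` (`A ≡ 35 L²` on the null cone). [folklore] -/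
theorem chartT_genA : chartT (genA a b d e f) = Polynomial.C 35 * chartT (genL a b d e f) ^ 2 := by
  unfold genA
  rw [chartT_add, chartT_sub, chartT_mul, chartT_C, chartT_pow, chartT_mul, chartT_mul, chartT_normSq, chartT_mul,
    chartT_pow, chartT_normSq]
  simp

/-- ★ **THE CHART IS MULTIPLICATIVE MODULO `ρ`, degree 6**: `chartT B = 77 · (chartT L)³`. [folklore] -/
theorem chartT_genB : chartT (genB a b d e f) = Polynomial.C 77 * chartT (genL a b d e f) ^ 3 := by
  unfold genB
  rw [chartT_add, chartT_add, chartT_sub, chartT_mul, chartT_C, chartT_pow, chartT_mul, chartT_mul, chartT_mul,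
    chartT_normSq, chartT_mul, chartT_mul, chartT_pow, chartT_normSq, chartT_mul, chartT_pow, chartT_normSq]
  simp

/-- ★ **INJECTIVITY CONSEQUENCE, degree 4**: a complex solid harmonic `H ∈ 𝓗₄` with `chartT H = c · (chartT L)²` is `(c/35) · A`.
[folklore] -/
theorem eq_C_mul_genA_of_chartT_eq {H : MvPolynomial (Fin 3) ℂ} (hH : H.IsHomogeneous 4) (hlap : lapP H = 0) {c : ℂ}
    (hc : chartT H = Polynomial.C c * chartT (genL a b d e f) ^ 2) : H = C (c / 35) * genA a b d e f := by
  have h0 : H - C (c / 35) * genA a b d e f = 0 := by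
    refine eq_zero_of_chartT_eq_zero (hH.sub ((isHomogeneous_genA a b d e f).C_mul _)) ?_ ?_
    · rw [lapP_sub, lapP_C_mul, lapP_genA, hlap, mul_zero, sub_zero]
    · rw [chartT_sub, chartT_mul, chartT_C, chartT_genA, hc, ← mul_assoc, ← Polynomial.C_mul,
        div_mul_cancel₀ c (by norm_num : (35 : ℂ) ≠ 0), sub_self]
  exact sub_eq_zero.mp h0

/-- ★ **INJECTIVITY CONSEQUENCE, degree 6**: a complex solid harmonic `H ∈ 𝓗₆` with `chartT H = c · (chartT L)³` is `(c/77) · B`.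
[folklore] -/
theorem eq_C_mul_genB_of_chartT_eq {H : MvPolynomial (Fin 3) ℂ} (hH : H.IsHomogeneous 6) (hlap : lapP H = 0) {c : ℂ}
    (hc : chartT H = Polynomial.C c * chartT (genL a b d e f) ^ 3) : H = C (c / 77) * genB a b d e f := by
  have h0 : H - C (c / 77) * genB a b d e f = 0 := by
    refine eq_zero_of_chartT_eq_zero (hH.sub ((isHomogeneous_genB a b d e f).C_mul _)) ?_ ?_
    · rw [lapP_sub, lapP_C_mul, lapP_genB, hlap, mul_zero, sub_zero]
    · rw [chartT_sub, chartT_mul, chartT_C, chartT_genB, hc, ← mul_assoc, ← Polynomial.C_mul,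
        div_mul_cancel₀ c (by norm_num : (77 : ℂ) ≠ 0), sub_self]
  exact sub_eq_zero.mp h0

/-- **The chart of the generator**: `chartT L = (a − b + 2id) + 4(e + if) t − 6(a + b) t² + 4(−e + if) t³ + (a − b − 2id) t⁴`.
[folklore] -/
theorem chartT_genL : chartT (genL a b d e f)
    = Polynomial.C (a - b + 2 * I * d) + Polynomial.C (4 * (e + I * f)) * Polynomial.X
      + Polynomial.C (-(6 * (a + b))) * Polynomial.X ^ 2 + Polynomial.C (4 * (-e + I * f)) * Polynomial.X ^ 3
      + Polynomial.C (a - b - 2 * I * d) * Polynomial.X ^ 4 := by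
  simp only [genL, genQ0, genQ1, genQ2, chartT_add, chartT_sub, chartT_mul, chartT_C, chartT_X_zero, chartT_X_one,
    chartT_X_two, Polynomial.C_add, Polynomial.C_sub, Polynomial.C_mul, Polynomial.C_neg]
  have hI : Polynomial.C I * Polynomial.C I = (-1 : Polynomial ℂ) := by
    rw [← Polynomial.C_mul, I_mul_I, Polynomial.C_neg, Polynomial.C_1]
  simp only [Polynomial.C_ofNat]
  linear_combination (Polynomial.C b * (1 + Polynomial.X ^ 2) ^ 2) * hI

/-- ★ **DEGREE-TWO CHART SURJECTIVITY**: every polynomial of degree `≤ 4` is the chart of a (complex, traceless symmetric) generator.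
[folklore] -/
theorem exists_gen_chartT_eq {q : Polynomial ℂ} (hq : q.natDegree ≤ 4) : ∃ a b d e f : ℂ, chartT (genL a b d e f) = q := by
  refine ⟨(q.coeff 0 + q.coeff 4) / 4 - q.coeff 2 / 12, -((q.coeff 0 + q.coeff 4) / 4) - q.coeff 2 / 12,
    -I * (q.coeff 0 - q.coeff 4) / 4, (q.coeff 1 - q.coeff 3) / 8, -I * (q.coeff 1 + q.coeff 3) / 8, ?_⟩
  rw [chartT_genL]
  have hq' : q = Polynomial.C (q.coeff 0) + Polynomial.C (q.coeff 1) * Polynomial.X + Polynomial.C (q.coeff 2) * Polynomial.X ^ 2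
      + Polynomial.C (q.coeff 3) * Polynomial.X ^ 3 + Polynomial.C (q.coeff 4) * Polynomial.X ^ 4 := by
    conv_lhs => rw [Polynomial.as_sum_range_C_mul_X_pow' (p := q) (n := 5) (by omega)]
    simp [Finset.sum_range_succ]
  conv_rhs => rw [hq']
  have hI : I * I = -1 := I_mul_I
  have e0 : (q.coeff 0 + q.coeff 4) / 4 - q.coeff 2 / 12 - (-((q.coeff 0 + q.coeff 4) / 4) - q.coeff 2 / 12)
      + 2 * I * (-I * (q.coeff 0 - q.coeff 4) / 4) = q.coeff 0 := by
    linear_combination (-(q.coeff 0 - q.coeff 4) / 2) * hI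
  have e1 : 4 * ((q.coeff 1 - q.coeff 3) / 8 + I * (-I * (q.coeff 1 + q.coeff 3) / 8)) = q.coeff 1 := by
    linear_combination (-(q.coeff 1 + q.coeff 3) / 2) * hI
  have e2 : -(6 * ((q.coeff 0 + q.coeff 4) / 4 - q.coeff 2 / 12 + (-((q.coeff 0 + q.coeff 4) / 4) - q.coeff 2 / 12)))
      = q.coeff 2 := by ring
  have e3 : 4 * (-((q.coeff 1 - q.coeff 3) / 8) + I * (-I * (q.coeff 1 + q.coeff 3) / 8)) = q.coeff 3 := by
    linear_combination (-(q.coeff 1 + q.coeff 3) / 2) * hI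
  have e4 : (q.coeff 0 + q.coeff 4) / 4 - q.coeff 2 / 12 - (-((q.coeff 0 + q.coeff 4) / 4) - q.coeff 2 / 12)
      - 2 * I * (-I * (q.coeff 0 - q.coeff 4) / 4) = q.coeff 4 := by
    linear_combination ((q.coeff 0 - q.coeff 4) / 2) * hI
  rw [e0, e1, e2, e3, e4]

end Chart

/-! ### Reality of the generator -/

/-- Complex conjugation fixes the complexification of a real polynomial. [folklore] -/
theorem map_conj_map_ofReal (P : MvPolynomial (Fin 3) ℝ) :
    map (starRingEnd ℂ) (map (algebraMap ℝ ℂ) P) = map (algebraMap ℝ ℂ) P := by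
  have hc : (starRingEnd ℂ).comp (algebraMap ℝ ℂ) = algebraMap ℝ ℂ := RingHom.ext fun r => Complex.conj_ofReal r
  rw [map_map, hc]

/-- ★ **REALITY OF THE GENERATOR.**  If a non-zero REAL polynomial `P` is `c · A(Q)` over `ℂ` for a complex traceless symmetric `Q`
(parameters `a, b, d, e, f`), then `Q = w • Q'` for some `w ∈ ℂ` and a REAL `Q'`. [folklore] -/
theorem exists_real_gen_of_map_eq_C_mul_genA {P : MvPolynomial (Fin 3) ℝ} (hP : P ≠ 0) {a b d e f c : ℂ}
    (h : map (algebraMap ℝ ℂ) P = C c * genA a b d e f) :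
    ∃ (w : ℂ) (a' b' d' e' f' : ℝ), a = w * a' ∧ b = w * b' ∧ d = w * d' ∧ e = w * e' ∧ f = w * f' := by
  set σ := starRingEnd ℂ with hσ
  -- conjugate the identity
  have hconj : C c * genA a b d e f = C (σ c) * genA (σ a) (σ b) (σ d) (σ e) (σ f) := by
    have := congrArg (map σ) h
    rw [map_conj_map_ofReal, h, map_mul, map_C, map_genA] at this
    exact this
  have hc : c ≠ 0 := by
    rintro rfl
    rw [C_0, zero_mul, map_eq_zero_iff _ (map_injective (algebraMap ℝ ℂ) (RCLike.ofReal_injective))] at h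
    exact hP h
  have hσc : σ c ≠ 0 := (map_ne_zero σ).mpr hc
  -- charts
  set p : Polynomial ℂ := chartT (genL a b d e f) with hp
  set p' : Polynomial ℂ := chartT (genL (σ a) (σ b) (σ d) (σ e) (σ f)) with hp'
  have hsq : p' ^ 2 = Polynomial.C (c / σ c) * p ^ 2 := by
    have h1 := congrArg chartT hconj
    rw [chartT_mul, chartT_C, chartT_genA, chartT_mul, chartT_C, chartT_genA, ← hp, ← hp'] at h1
    have h2 : Polynomial.C (σ c * 35) * (p' ^ 2 - Polynomial.C (c / σ c) * p ^ 2) = 0 := by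
      rw [mul_sub, ← mul_assoc, ← Polynomial.C_mul, show σ c * 35 * (c / σ c) = c * 35 by field_simp]
      rw [Polynomial.C_mul, Polynomial.C_mul]
      linear_combination -h1
    rcases mul_eq_zero.mp h2 with h3 | h3
    · exact absurd (Polynomial.C_eq_zero.mp h3) (mul_ne_zero hσc (by norm_num))
    · exact sub_eq_zero.mp h3
  obtain ⟨u, hu⟩ := IsAlgClosed.exists_pow_nat_eq (c / σ c) (by norm_num : 0 < 2)
  have hsq' : p' ^ 2 = (Polynomial.C u * p) ^ 2 := by rw [hsq, mul_pow, ← Polynomial.C_pow, hu]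
  -- `p' = ± u · p`
  obtain ⟨u', hu'abs, hp'u⟩ : ∃ u' : ℂ, u' ^ 2 = c / σ c ∧ p' = Polynomial.C u' * p := by
    rcases sq_eq_sq_iff_eq_or_eq_neg.mp hsq' with h3 | h3
    · exact ⟨u, hu, h3⟩
    · exact ⟨-u, by rw [neg_sq, hu], by rw [h3, Polynomial.C_neg, neg_mul]⟩
  -- injectivity of the chart on harmonic quadratics: `L_{σQ} = u' · L_Q`
  have hLeq : genL (σ a) (σ b) (σ d) (σ e) (σ f) = C u' * genL a b d e f := by
    have h0 : genL (σ a - u' * a) (σ b - u' * b) (σ d - u' * d) (σ e - u' * e) (σ f - u' * f) = 0 := by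
      refine eq_zero_of_chartT_eq_zero (isHomogeneous_genL _ _ _ _ _) (lapP_genL _ _ _ _ _) ?_
      rw [genL_sub, genL_smul, chartT_sub, chartT_mul, chartT_C, ← hp, ← hp', hp'u, sub_self]
    have := genL_sub (σ a) (σ b) (σ d) (σ e) (σ f) (u' * a) (u' * b) (u' * d) (u' * e) (u' * f)
    rw [h0, genL_smul] at this
    exact (sub_eq_zero.mp this.symm)
  have hcomp : σ a = u' * a ∧ σ b = u' * b ∧ σ d = u' * d ∧ σ e = u' * e ∧ σ f = u' * f := by
    have h0 : genL (σ a - u' * a) (σ b - u' * b) (σ d - u' * d) (σ e - u' * e) (σ f - u' * f) = 0 := by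
      rw [genL_sub, genL_smul, hLeq, sub_self]
    obtain ⟨h1, h2, h3, h4, h5⟩ := gen_eq_zero_of_genL_eq_zero h0
    exact ⟨sub_eq_zero.mp h1, sub_eq_zero.mp h2, sub_eq_zero.mp h3, sub_eq_zero.mp h4, sub_eq_zero.mp h5⟩
  -- trivial case `Q = 0`
  by_cases hz : a = 0 ∧ b = 0 ∧ d = 0 ∧ e = 0 ∧ f = 0
  · obtain ⟨rfl, rfl, rfl, rfl, rfl⟩ := hz
    exact ⟨1, 0, 0, 0, 0, 0, by simp, by simp, by simp, by simp, by simp⟩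
  -- otherwise `|u'| = 1`; take `w⁻¹` with `w² = u'`
  have hunit : ‖u'‖ = 1 := by
    obtain ⟨z, hz0, hzσ⟩ : ∃ z : ℂ, z ≠ 0 ∧ σ z = u' * z := by
      simp only [not_and_or] at hz
      rcases hz with h1 | h1 | h1 | h1 | h1
      · exact ⟨a, h1, hcomp.1⟩
      · exact ⟨b, h1, hcomp.2.1⟩
      · exact ⟨d, h1, hcomp.2.2.1⟩
      · exact ⟨e, h1, hcomp.2.2.2.1⟩
      · exact ⟨f, h1, hcomp.2.2.2.2⟩
    have h1 := congrArg (fun t : ℂ => ‖t‖) hzσ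
    simp only [norm_mul, hσ, Complex.norm_conj] at h1
    have hz' : ‖z‖ ≠ 0 := norm_ne_zero_iff.mpr hz0
    field_simp at h1
    linarith [h1]
  obtain ⟨w, hw⟩ := IsAlgClosed.exists_pow_nat_eq u' (by norm_num : 0 < 2)
  have hwunit : ‖w‖ = 1 := by
    have h1 := congrArg (fun t : ℂ => ‖t‖) hw
    simp only [norm_pow, hunit] at h1
    nlinarith [norm_nonneg w, h1]
  have hw0 : w ≠ 0 := fun h0 => by rw [h0, norm_zero] at hwunit; exact zero_ne_one hwunit
  have hwσ : σ w * w = 1 := by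
    rw [hσ, mul_comm, Complex.mul_conj, Complex.normSq_eq_norm_sq, hwunit]; simp
  -- `w · z` is real for every parameter `z`
  have hreal : ∀ z : ℂ, σ z = u' * z → ∃ r : ℝ, z = w⁻¹ * r := by
    intro z hzσ
    refine ⟨(w * z).re, ?_⟩
    have hfix : σ (w * z) = w * z := by
      rw [map_mul, hzσ, ← hw]
      linear_combination (w * z) * hwσ
    have hre : ((w * z).re : ℂ) = w * z := Complex.conj_eq_iff_re.mp hfix
    rw [hre, ← mul_assoc, inv_mul_cancel₀ hw0, one_mul]
  obtain ⟨ra, hra⟩ := hreal a hcomp.1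
  obtain ⟨rb, hrb⟩ := hreal b hcomp.2.1
  obtain ⟨rd, hrd⟩ := hreal d hcomp.2.2.1
  obtain ⟨re', hre'⟩ := hreal e hcomp.2.2.2.1
  obtain ⟨rf, hrf⟩ := hreal f hcomp.2.2.2.2
  exact ⟨w⁻¹, ra, rb, rd, re', rf, hra, hrb, hrd, hre', hrf⟩

end Summit.NavierStokesRegularity.NavierStokesRegularity.Theorems.PoloidalLiouville.HorizonTower.Zonal

end
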